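import Literature.AlgebraicGeometry.Motives.HodgeLieWeightOneRankFourBasis
import HarnessLib

/-!
# Weight-one Hodge structures with Hodge group of rank four, not of CM type. C: the centre of `(Lie Hg)_ℂ` is a line
# spanned by a RATIONAL element `φ ∈ Lie Hg ∩ Z(End_Hdg)`

Family `hodge`, layer `Literature/AlgebraicGeometry/Motives`; THEOREMS ONLY (no definition, no named fact; D-0026).
Third file of the lane MT-RANK-FIVE of the cell `pub-hodgecm2` (setting as in `Motives/HodgeLieWeightOneRankFourBlocks`,
with `dim_ℚ 𝔥 = 4` and `X ∈ 𝔥 ∖ End_Hdg(V)`).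

* §1 `exists_central_basis_of_finrank_eq_four` — **`𝔥_ℂ = ℂ(2P−1) ⊕ ℂE ⊕ ℂF ⊕ ℂZ` with `Z` CENTRAL**, `Z P = P Z`,
  `[E, F] = α(2P−1) + βZ`: from the diagonal `D` of file B, `[D,E] = λE`, `[D,F] = λ'F`, `[E,F] ∈ ℂ(2P−1) ⊕ ℂD`, and
  the Jacobi identity `0 = [D,[E,F]] = (λ+λ')[E,F]` with `[E,F] ≠ 0` forces `λ' = −λ`; `Z = D − (λ/2)(2P−1)`
  (`𝔥_ℂ ≅ 𝔰𝔩₂ ⊕ ℂ = 𝔤𝔩₂`).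
* §2 `exists_rat_central_of_finrank_eq_four` — **a RATIONAL central element**: `φ ∈ 𝔥`, `φ ≠ 0`, a Hodge endomorphism
  commuting with `End_Hdg(V)`, with `𝔥_ℂ = ℂ(2P−1) ⊕ ℂE ⊕ ℂF ⊕ ℂφ_ℂ`, `[E,F] = α(2P−1) + βφ_ℂ` (`Z ∈ End_Hdg ⊗ ℂ` by
  Zarhin's commutant theorem with descent; the rational coordinates `ratCoord` of `Z` lie in `𝔥 ∩ End_Hdg`; a non-zero
  one is central in `𝔥_ℂ`, hence in `ℂZ`).  Classically (`MT = 𝔾ₘ · Hg`, Moonen–Zarhin §2): `Hg⁰ = SL₂ · U(1)` up to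
  isogeny with `U(1) ⊂ Z(End⁰)^×`.

## References

* [MoonenZarhin1999LowDim] B. Moonen, Yu. Zarhin, *Hodge classes on abelian varieties of low dimension*, Math. Ann. 315
  (1999), §2.
* [Deligne1982HodgeCycles] P. Deligne, *Hodge cycles on abelian varieties*, LNM 900 (1982), I §3 (3.1–3.4).
* [FultonHarris1991] W. Fulton, J. Harris, *Representation Theory*, GTM 129 (1991), §9.3, Lecture 11 (§11.1).
* [Zarhin1983HodgeGroupsK3] Yu. G. Zarhin, *Hodge groups of K3 surfaces*, J. reine angew. Math. 341 (1983), §2.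
-/

noncomputable section

open scoped TensorProduct

namespace Literature.AlgebraicGeometry.Motives

universe u

namespace HodgeStructure

open ProjectorBlocks

variable {V : Type u} [AddCommGroup V] [Module ℚ V] [Module.Finite ℚ V] [HodgeTensorFacts.{u, u}] {n : ℤ}
  {S : Type u} [Fintype S] [DecidableEq S] {deg : S → ℤ}

/-! ## §1 The central element of `𝔥_ℂ` -/

/-- **`𝔥_ℂ = ℂ(2P − 1) ⊕ ℂE ⊕ ℂF ⊕ ℂZ` with `Z` central**, `Z P = P Z`, and `[E, F] = α(2P − 1) + βZ`
(`X ∈ 𝔥 ∖ End_Hdg(V)`, `dim_ℚ 𝔥 = 4`, weight `1`, degrees in `{0,1}`, `ψ` a polarization): with the diagonal `D` of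
`exists_diag_basis_of_finrank_eq_four`, `[D, E] = λ E`, `[D, F] = λ' F`, `[E, F] = α(2P−1) + β' D`, and
`0 = [D, [E, F]] = (λ + λ')[E, F]`, `[E, F] ≠ 0`, so `λ' = −λ` and `Z = D − (λ/2)(2P − 1)` is central — the decomposition
`𝔥_ℂ = 𝔰𝔩₂ ⊕ 𝔷` of the reductive `Lie Hg ⊗ ℂ`. [cite: MoonenZarhin1999LowDim, §2] [cite: FultonHarris1991, §9.3 and Lecture 11 (§11.1)] -/
theorem exists_central_basis_of_finrank_eq_four (H : HodgeStructure V n) (ψ : H.Polarization) (hn : n = 1)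
    (e : Module.Basis S ℂ (ℂ ⊗[ℚ] V)) (hF : ∀ a, H.F a = Submodule.span ℂ (e '' {σ | a ≤ deg σ}))
    (hFc : ∀ a, complexConj (H.F a) = Submodule.span ℂ (e '' {σ | deg σ ≤ n - a}))
    (hdeg : ∀ σ, deg σ = 0 ∨ deg σ = 1) {X : Module.End ℚ V} (hX : X ∈ H.hodgeLie) (hXE : X ∉ H.endAlg)
    (h4 : Module.finrank ℚ H.hodgeLie = 4) :
    ∃ Z ∈ H.hodgeLieC, Z * gradingEnd e deg = gradingEnd e deg * Z ∧ (∀ W ∈ H.hodgeLieC, Z * W = W * Z) ∧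
      LinearIndependent ℂ ![(2 : ℂ) • gradingEnd e deg - 1,
        gradingEnd e deg * X.baseChange ℂ * (1 - gradingEnd e deg),
        (1 - gradingEnd e deg) * X.baseChange ℂ * gradingEnd e deg, Z] ∧
      (∀ W ∈ H.hodgeLieC, ∃ c : Fin 4 → ℂ, W = c 0 • ((2 : ℂ) • gradingEnd e deg - 1) +
        c 1 • (gradingEnd e deg * X.baseChange ℂ * (1 - gradingEnd e deg)) +
        c 2 • ((1 - gradingEnd e deg) * X.baseChange ℂ * gradingEnd e deg) + c 3 • Z) ∧
      ∃ α β : ℂ, (gradingEnd e deg * X.baseChange ℂ * (1 - gradingEnd e deg)) *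
          ((1 - gradingEnd e deg) * X.baseChange ℂ * gradingEnd e deg) -
        ((1 - gradingEnd e deg) * X.baseChange ℂ * gradingEnd e deg) *
          (gradingEnd e deg * X.baseChange ℂ * (1 - gradingEnd e deg)) =
        α • ((2 : ℂ) • gradingEnd e deg - 1) + β • Z := by
  classical
  subst hn
  obtain ⟨D, hDM, hDP, hli, hspan⟩ := exists_diag_basis_of_finrank_eq_four H rfl e hF hFc hdeg hX hXE h4
  have hcomm0 := commutator_projE_projF_ne_zero H ψ rfl e hF hFc hdeg hX hXE
  set P := gradingEnd e deg with hP
  set Y := X.baseChange ℂ with hY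
  set E := P * Y * (1 - P) with hEdef
  set F := (1 - P) * Y * P with hFdef
  have hPP : P * P = P := gradingEnd_mul_gradingEnd_of_deg e hdeg
  have hPE : P * E = E := by rw [hEdef, ← mul_assoc, ← mul_assoc, hPP]
  have hEP : E * P = 0 := by rw [hEdef, mul_assoc (P * Y) (1 - P) P, sub_mul, one_mul, hPP, sub_self, mul_zero]
  have hPF : P * F = 0 := by
    rw [hFdef, mul_assoc (1 - P) Y P, ← mul_assoc P (1 - P) (Y * P), mul_sub, mul_one, hPP, sub_self, zero_mul]
  have hFP : F * P = F := by rw [hFdef, mul_assoc ((1 - P) * Y) P P, hPP]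
  obtain ⟨hE0, hF0⟩ := projE_ne_zero_of_not_mem_endAlg H rfl e hF hFc hdeg hXE
  rw [← hP, ← hY, ← hEdef] at hE0; rw [← hP, ← hY, ← hFdef] at hF0
  have hYM : Y ∈ H.hodgeLieC := H.baseChange_mem_hodgeLieC hX
  obtain ⟨hEM, hFM⟩ := projE_mem_hodgeLieC H e hF hFc hdeg hYM
  rw [← hP, ← hEdef] at hEM; rw [← hP, ← hFdef] at hFM
  have hΘ' : (2 : ℂ) • P - 1 ∈ H.hodgeLieC := by
    simpa only [Int.cast_one, one_smul] using two_smul_gradingEnd_sub_mem_hodgeLieC H e hF hFc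
  -- block types of the products
  have hPDE : P * (D * E) = D * E := by rw [← mul_assoc P D E, ← hDP, mul_assoc D P E, hPE]
  have hDEP : D * E * P = 0 := by rw [mul_assoc D E P, hEP, mul_zero]
  have hPED : P * (E * D) = E * D := by rw [← mul_assoc P E D, hPE]
  have hEDP : E * D * P = 0 := by rw [mul_assoc E D P, hDP, ← mul_assoc E P D, hEP, zero_mul]
  have hPDF : P * (D * F) = 0 := by rw [← mul_assoc P D F, ← hDP, mul_assoc D P F, hPF, mul_zero]
  have hDFP : D * F * P = D * F := by rw [mul_assoc D F P, hFP]
  have hPFD : P * (F * D) = 0 := by rw [← mul_assoc P F D, hPF, zero_mul]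
  have hFDP : F * D * P = F * D := by rw [mul_assoc F D P, hDP, ← mul_assoc F P D, hFP]
  have hEFP : E * F * P = P * (E * F) := by rw [mul_assoc E F P, hFP, ← mul_assoc P E F, hPE]
  have hFEP : F * E * P = P * (F * E) := by rw [mul_assoc F E P, hEP, mul_zero, ← mul_assoc P F E, hPF, zero_mul]
  -- `[D, E] = λ E`
  obtain ⟨c, hc⟩ := hspan _ (H.commutator_mem_hodgeLieC hDM hEM)
  have hDE : D * E - E * D = c 1 • E := by
    have h : P * (D * E - E * D) * (1 - P) =
        P * (c 0 • ((2 : ℂ) • P - 1) + c 1 • E + c 2 • F + c 3 • D) * (1 - P) :=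
      congrArg (fun T : Module.End ℂ (ℂ ⊗[ℚ] V) => P * T * (1 - P)) hc
    rw [mul_sub P (D * E) (E * D), sub_mul (P * (D * E)) (P * (E * D)) (1 - P), (blocks_E hPDE hDEP).1,
      (blocks_E hPED hEDP).1] at h
    simp only [mul_add, add_mul, mul_smul_comm, smul_mul_assoc, (blocks_theta hPP).1, (blocks_E hPE hEP).1,
      (blocks_F hPF hFP).1, (blocks_D hPP hDP).1, smul_zero, zero_add, add_zero] at h
    exact h
  -- `[D, F] = λ' F`
  obtain ⟨c', hc'⟩ := hspan _ (H.commutator_mem_hodgeLieC hDM hFM)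
  have hDF : D * F - F * D = c' 2 • F := by
    have h : (1 - P) * (D * F - F * D) * P =
        (1 - P) * (c' 0 • ((2 : ℂ) • P - 1) + c' 1 • E + c' 2 • F + c' 3 • D) * P :=
      congrArg (fun T : Module.End ℂ (ℂ ⊗[ℚ] V) => (1 - P) * T * P) hc'
    rw [mul_sub (1 - P) (D * F) (F * D), sub_mul ((1 - P) * (D * F)) ((1 - P) * (F * D)) P, (blocks_F hPDF hDFP).2,
      (blocks_F hPFD hFDP).2] at h
    simp only [mul_add, add_mul, mul_smul_comm, smul_mul_assoc, (blocks_theta hPP).2, (blocks_E hPE hEP).2,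
      (blocks_F hPF hFP).2, (blocks_D hPP hDP).2, smul_zero, zero_add, add_zero] at h
    exact h
  -- `[E, F] = a₀ (2P−1) + a₃ D`
  obtain ⟨a, ha⟩ := hspan _ (H.commutator_mem_hodgeLieC hEM hFM)
  have ha1 : a 1 = 0 := by
    have h : P * (E * F - F * E) * (1 - P) =
        P * (a 0 • ((2 : ℂ) • P - 1) + a 1 • E + a 2 • F + a 3 • D) * (1 - P) :=
      congrArg (fun T : Module.End ℂ (ℂ ⊗[ℚ] V) => P * T * (1 - P)) ha
    rw [mul_sub P (E * F) (F * E), sub_mul (P * (E * F)) (P * (F * E)) (1 - P), (blocks_D hPP hEFP).1,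
      (blocks_D hPP hFEP).1, sub_self] at h
    simp only [mul_add, add_mul, mul_smul_comm, smul_mul_assoc, (blocks_theta hPP).1, (blocks_E hPE hEP).1,
      (blocks_F hPF hFP).1, (blocks_D hPP hDP).1, smul_zero, zero_add, add_zero] at h
    exact (smul_eq_zero.1 h.symm).resolve_right hE0
  have ha2 : a 2 = 0 := by
    have h : (1 - P) * (E * F - F * E) * P =
        (1 - P) * (a 0 • ((2 : ℂ) • P - 1) + a 1 • E + a 2 • F + a 3 • D) * P :=
      congrArg (fun T : Module.End ℂ (ℂ ⊗[ℚ] V) => (1 - P) * T * P) ha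
    rw [mul_sub (1 - P) (E * F) (F * E), sub_mul ((1 - P) * (E * F)) ((1 - P) * (F * E)) P, (blocks_D hPP hEFP).2,
      (blocks_D hPP hFEP).2, sub_self] at h
    simp only [mul_add, add_mul, mul_smul_comm, smul_mul_assoc, (blocks_theta hPP).2, (blocks_E hPE hEP).2,
      (blocks_F hPF hFP).2, (blocks_D hPP hDP).2, smul_zero, zero_add, add_zero] at h
    exact (smul_eq_zero.1 h.symm).resolve_right hF0
  rw [ha1, ha2, zero_smul, zero_smul, add_zero, add_zero] at ha
  -- Jacobi: `(λ + λ') [E, F] = 0`, hence `λ' = -λ`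
  have hDΘ : D * ((2 : ℂ) • P - 1) = ((2 : ℂ) • P - 1) * D := by
    rw [mul_sub, sub_mul, mul_smul_comm, smul_mul_assoc, hDP, mul_one, one_mul]
  have hJ : D * (E * F - F * E) - (E * F - F * E) * D =
      (D * E - E * D) * F + E * (D * F - F * D) - ((D * F - F * D) * E + F * (D * E - E * D)) := by
    simp only [mul_sub, sub_mul, mul_assoc]
    abel
  have hJ0 : D * (E * F - F * E) - (E * F - F * E) * D = 0 := by
    rw [ha]
    simp only [mul_add, add_mul, mul_smul_comm, smul_mul_assoc, hDΘ, sub_self]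
  have h2 : (D * E - E * D) * F + E * (D * F - F * D) - ((D * F - F * D) * E + F * (D * E - E * D)) = 0 := hJ ▸ hJ0
  rw [hDE, hDF, smul_mul_assoc, mul_smul_comm, smul_mul_assoc, mul_smul_comm] at h2
  have hsum : (c 1 + c' 2) • (E * F - F * E) = 0 := by
    calc (c 1 + c' 2) • (E * F - F * E)
        = c 1 • (E * F) + c' 2 • (E * F) - (c' 2 • (F * E) + c 1 • (F * E)) := by
          rw [add_smul, smul_sub, smul_sub]; abel
      _ = 0 := h2
  have hlam : c' 2 + c 1 = 0 := by rw [add_comm]; exact (smul_eq_zero.1 hsum).resolve_right hcomm0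
  have htwo : c 1 / 2 * 2 = c 1 := by ring
  -- the central element
  set Z := D - (c 1 / 2) • ((2 : ℂ) • P - 1) with hZdef
  clear_value Z
  have hZM : Z ∈ H.hodgeLieC := hZdef ▸ H.hodgeLieC.sub_mem hDM (H.hodgeLieC.smul_mem _ hΘ')
  have hZP : Z * P = P * Z := by
    rw [hZdef, sub_mul D _ P, mul_sub P D, smul_mul_assoc, mul_smul_comm, (mul_theta hPP).1, (mul_theta hPP).2, hDP]
  have hZΘ : Z * ((2 : ℂ) • P - 1) = ((2 : ℂ) • P - 1) * Z := by
    rw [mul_sub Z _ 1, sub_mul _ 1 Z, mul_smul_comm, smul_mul_assoc, hZP, mul_one, one_mul]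
  have hZE : Z * E = E * Z := by
    rw [← sub_eq_zero, hZdef, sub_mul D _ E, mul_sub E D, smul_mul_assoc, mul_smul_comm]
    have h : D * E - (c 1 / 2) • (((2 : ℂ) • P - 1) * E) - (E * D - (c 1 / 2) • (E * ((2 : ℂ) • P - 1))) =
        (D * E - E * D) - (c 1 / 2) • (((2 : ℂ) • P - 1) * E - E * ((2 : ℂ) • P - 1)) := by
      rw [smul_sub]; abel
    rw [h, hDE, (theta_bracket hPE hEP hPF hFP).1, smul_smul, htwo, sub_self]
  have hZF : Z * F = F * Z := by
    rw [← sub_eq_zero, hZdef, sub_mul D _ F, mul_sub F D, smul_mul_assoc, mul_smul_comm]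
    have h : D * F - (c 1 / 2) • (((2 : ℂ) • P - 1) * F) - (F * D - (c 1 / 2) • (F * ((2 : ℂ) • P - 1))) =
        (D * F - F * D) - (c 1 / 2) • (((2 : ℂ) • P - 1) * F - F * ((2 : ℂ) • P - 1)) := by
      rw [smul_sub]; abel
    rw [h, hDF, (theta_bracket hPE hEP hPF hFP).2, smul_neg, smul_smul, htwo, sub_neg_eq_add, ← add_smul, hlam,
      zero_smul]
  have hZD : Z * D = D * Z := by rw [hZdef, sub_mul D _ D, mul_sub D D, smul_mul_assoc, mul_smul_comm, hDΘ]
  have hZcen : ∀ W ∈ H.hodgeLieC, Z * W = W * Z := by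
    intro W hW
    obtain ⟨w, hw⟩ := hspan W hW
    rw [hw]
    simp only [mul_add, add_mul, mul_smul_comm, smul_mul_assoc, hZΘ, hZE, hZF, hZD]
  -- basis property with `Z` in place of `D`
  have hDZ : D = Z + (c 1 / 2) • ((2 : ℂ) • P - 1) := by rw [hZdef, sub_add_cancel]
  have hliZ : LinearIndependent ℂ ![(2 : ℂ) • P - 1, E, F, Z] := by
    rw [Fintype.linearIndependent_iff]
    intro g hg
    have hg' : g 0 • ((2 : ℂ) • P - 1) + g 1 • E + g 2 • F + g 3 • Z = 0 := by
      simpa [Fin.sum_univ_four] using hg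
    have hg'' : (g 0 - g 3 * (c 1 / 2)) • ((2 : ℂ) • P - 1) + g 1 • E + g 2 • F + g 3 • D = 0 := by
      rw [hZdef, smul_sub (g 3) D, smul_smul (g 3) (c 1 / 2)] at hg'
      have hsub : (g 0 - g 3 * (c 1 / 2)) • ((2 : ℂ) • P - 1) =
          g 0 • ((2 : ℂ) • P - 1) - (g 3 * (c 1 / 2)) • ((2 : ℂ) • P - 1) :=
        sub_smul (M := Module.End ℂ (ℂ ⊗[ℚ] V)) _ _ _
      calc (g 0 - g 3 * (c 1 / 2)) • ((2 : ℂ) • P - 1) + g 1 • E + g 2 • F + g 3 • D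
          = g 0 • ((2 : ℂ) • P - 1) + g 1 • E + g 2 • F + (g 3 • D - (g 3 * (c 1 / 2)) • ((2 : ℂ) • P - 1)) := by
            rw [hsub]; abel
        _ = 0 := hg'
    have h := Fintype.linearIndependent_iff.1 hli ![g 0 - g 3 * (c 1 / 2), g 1, g 2, g 3]
      (by simpa [Fin.sum_univ_four] using hg'')
    have h3 : g 3 = 0 := by simpa using h 3
    have h0 : g 0 = 0 := by simpa [h3] using h 0
    have h1 : g 1 = 0 := by simpa using h 1
    have h2' : g 2 = 0 := by simpa using h 2
    intro i
    fin_cases i <;> assumption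
  have hspanZ : ∀ W ∈ H.hodgeLieC, ∃ c₁ : Fin 4 → ℂ, W = c₁ 0 • ((2 : ℂ) • P - 1) + c₁ 1 • E + c₁ 2 • F + c₁ 3 • Z := by
    intro W hW
    obtain ⟨w, hw⟩ := hspan W hW
    refine ⟨![w 0 + w 3 * (c 1 / 2), w 1, w 2, w 3], ?_⟩
    show W = (w 0 + w 3 * (c 1 / 2)) • ((2 : ℂ) • P - 1) + w 1 • E + w 2 • F + w 3 • Z
    rw [hw, hDZ, smul_add (w 3) Z, smul_smul (w 3) (c 1 / 2), add_smul]
    abel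
  refine ⟨Z, hZM, hZP, hZcen, hliZ, hspanZ, a 0 + a 3 * (c 1 / 2), a 3, ?_⟩
  rw [ha, hDZ, smul_add (a 3) Z, smul_smul (a 3) (c 1 / 2), add_smul]
  abel

/-! ## §2 A rational central element -/

omit [Module.Finite ℚ V] [HodgeTensorFacts.{u, u}] [Fintype S] [DecidableEq S] in
/-- The rational coordinates (`ratCoord`) of an element of the complexification `N ⊗ ℂ ⊆ ℂ ⊗ M` of a rational subspace
`N ⊆ M` lie in `N` (`N ⊗ ℂ` is the range of `(N ↪ M)_ℂ` and `ratCoord` is natural). [cite: Deligne1982HodgeCycles, I §3 (proof of Prop. 3.4)] -/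
theorem ratCoord_mem_of_mem_baseChange {M : Type u} [AddCommGroup M] [Module ℚ M] (N : Submodule ℚ M)
    {x : ℂ ⊗[ℚ] M} (hx : x ∈ N.baseChange ℂ) (i : Module.Free.ChooseBasisIndex ℚ ℂ) : ratCoord M x i ∈ N := by
  obtain ⟨y, rfl⟩ : ∃ y, (N.subtype.baseChange ℂ) y = x := hx
  rw [ratCoord_baseChange]
  exact (ratCoord N y i).2

omit [HodgeTensorFacts.{u, u}] [Fintype S] [DecidableEq S] in
/-- An element of `span_ℂ {X_ℂ | X ∈ N}` corresponds, under `ℂ ⊗ End_ℚ V ≃ End_ℂ V_ℂ` (`endBaseChangeEquiv`), to an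
element of `N ⊗ ℂ`. [cite: Deligne1982HodgeCycles, I §3 (proof of Prop. 3.4)] -/
theorem endBaseChangeEquiv_symm_mem_baseChange (N : Submodule ℚ (Module.End ℚ V)) {Z : Module.End ℂ (ℂ ⊗[ℚ] V)}
    (hZ : Z ∈ Submodule.span ℂ ((fun X : Module.End ℚ V => X.baseChange ℂ) '' (N : Set (Module.End ℚ V)))) :
    (endBaseChangeEquiv V).symm Z ∈ N.baseChange ℂ := by
  induction hZ using Submodule.span_induction with
  | mem Z' hZ' =>
    obtain ⟨X, hX, rfl⟩ := hZ'
    have h : (endBaseChangeEquiv V).symm (X.baseChange ℂ) = (1 : ℂ) ⊗ₜ[ℚ] X := by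
      rw [LinearEquiv.symm_apply_eq, endBaseChangeEquiv_tmul, one_smul]
    rw [h]
    exact Submodule.tmul_mem_baseChange_of_mem 1 hX
  | zero => simp
  | add x y _ _ hx hy => simpa only [map_add] using Submodule.add_mem _ hx hy
  | smul c x _ hx => simpa only [map_smul] using Submodule.smul_mem _ c hx

/-- **A rational central element of `Lie Hg`.**  For `X ∈ 𝔥 ∖ End_Hdg(V)` and `dim_ℚ 𝔥 = 4` (polarizable weight-one `H`,
degrees in `{0,1}`) there is `φ ∈ 𝔥`, `φ ≠ 0`, a Hodge endomorphism commuting with all of `End_Hdg(V)`, with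
`𝔥_ℂ = ℂ(2P−1) ⊕ ℂE ⊕ ℂF ⊕ ℂφ_ℂ` and `[E, F] = α(2P−1) + βφ_ℂ`: the central `Z` lies in `End_Hdg ⊗ ℂ` (commutant theorem
with descent, `mem_span_endAlg_of_forall_commute`), its rational coordinates lie in `𝔥 ∩ End_Hdg`, a non-zero one `φ`
has `φ_ℂ` central in `𝔥_ℂ` (`commute_baseChange_of_mem_hodgeLieC`), whence `φ_ℂ ∈ ℂZ ∖ 0` (blocks, `[2P−1, E] = 2E`).
Classically: the centre of `Hg` is a one-dimensional `ℚ`-torus in `Z(End⁰)^×`. [cite: MoonenZarhin1999LowDim, §2]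
[cite: Zarhin1983HodgeGroupsK3, §2] [cite: Deligne1982HodgeCycles, I §3 (proof of Prop. 3.4)] -/
theorem exists_rat_central_of_finrank_eq_four (H : HodgeStructure V n) (ψ : H.Polarization) (hn : n = 1)
    (e : Module.Basis S ℂ (ℂ ⊗[ℚ] V)) (hF : ∀ a, H.F a = Submodule.span ℂ (e '' {σ | a ≤ deg σ}))
    (hFc : ∀ a, complexConj (H.F a) = Submodule.span ℂ (e '' {σ | deg σ ≤ n - a}))
    (hdeg : ∀ σ, deg σ = 0 ∨ deg σ = 1) {X : Module.End ℚ V} (hX : X ∈ H.hodgeLie) (hXE : X ∉ H.endAlg)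
    (h4 : Module.finrank ℚ H.hodgeLie = 4) :
    ∃ φ : Module.End ℚ V, φ ∈ H.hodgeLie ∧ φ ≠ 0 ∧ φ ∈ H.endAlg ∧ (∀ a ∈ H.endAlg, φ * a = a * φ) ∧
      LinearIndependent ℂ ![(2 : ℂ) • gradingEnd e deg - 1,
        gradingEnd e deg * X.baseChange ℂ * (1 - gradingEnd e deg),
        (1 - gradingEnd e deg) * X.baseChange ℂ * gradingEnd e deg, φ.baseChange ℂ] ∧
      (∀ W ∈ H.hodgeLieC, ∃ c : Fin 4 → ℂ, W = c 0 • ((2 : ℂ) • gradingEnd e deg - 1) +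
        c 1 • (gradingEnd e deg * X.baseChange ℂ * (1 - gradingEnd e deg)) +
        c 2 • ((1 - gradingEnd e deg) * X.baseChange ℂ * gradingEnd e deg) + c 3 • φ.baseChange ℂ) ∧
      ∃ α β : ℂ, (gradingEnd e deg * X.baseChange ℂ * (1 - gradingEnd e deg)) *
          ((1 - gradingEnd e deg) * X.baseChange ℂ * gradingEnd e deg) -
        ((1 - gradingEnd e deg) * X.baseChange ℂ * gradingEnd e deg) *
          (gradingEnd e deg * X.baseChange ℂ * (1 - gradingEnd e deg)) =
        α • ((2 : ℂ) • gradingEnd e deg - 1) + β • φ.baseChange ℂ := by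
  classical
  subst hn
  obtain ⟨Z, hZM, -, hZcen, hli, hspan, α, β, hEF⟩ :=
    exists_central_basis_of_finrank_eq_four H ψ rfl e hF hFc hdeg hX hXE h4
  set P := gradingEnd e deg with hP
  set Y := X.baseChange ℂ with hY
  set E := P * Y * (1 - P) with hEdef
  set F := (1 - P) * Y * P with hFdef
  have hPP : P * P = P := gradingEnd_mul_gradingEnd_of_deg e hdeg
  have hPE : P * E = E := by rw [hEdef, ← mul_assoc, ← mul_assoc, hPP]
  have hEP : E * P = 0 := by rw [hEdef, mul_assoc (P * Y) (1 - P) P, sub_mul, one_mul, hPP, sub_self, mul_zero]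
  have hPF : P * F = 0 := by
    rw [hFdef, mul_assoc (1 - P) Y P, ← mul_assoc P (1 - P) (Y * P), mul_sub, mul_one, hPP, sub_self, zero_mul]
  have hFP : F * P = F := by rw [hFdef, mul_assoc ((1 - P) * Y) P P, hPP]
  obtain ⟨hE0, hF0⟩ := projE_ne_zero_of_not_mem_endAlg H rfl e hF hFc hdeg hXE
  rw [← hP, ← hY, ← hEdef] at hE0; rw [← hP, ← hY, ← hFdef] at hF0
  have hYM : Y ∈ H.hodgeLieC := H.baseChange_mem_hodgeLieC hX
  obtain ⟨hEM, -⟩ := projE_mem_hodgeLieC H e hF hFc hdeg hYM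
  rw [← hP, ← hEdef] at hEM
  have hΘ' : (2 : ℂ) • P - 1 ∈ H.hodgeLieC := by
    simpa only [Int.cast_one, one_smul] using two_smul_gradingEnd_sub_mem_hodgeLieC H e hF hFc
  have hZP : Z * P = P * Z := by
    have h := hZcen _ hΘ'
    rw [mul_sub Z _ 1, sub_mul _ 1 Z, mul_one, one_mul, mul_smul_comm, smul_mul_assoc, sub_left_inj] at h
    exact smul_right_injective _ (two_ne_zero' ℂ) h
  -- `Z ∈ End_Hdg ⊗ ℂ`, and its rational coordinates
  have hZA : Z ∈ Submodule.span ℂ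
      ((fun a : Module.End ℚ V => a.baseChange ℂ) '' (H.endAlg : Set (Module.End ℚ V))) :=
    H.mem_span_endAlg_of_forall_commute fun X' hX' => hZcen _ (H.baseChange_mem_hodgeLieC hX')
  set ξ := (endBaseChangeEquiv V).symm Z with hξ
  have hξh : ξ ∈ H.hodgeLie.baseChange ℂ := endBaseChangeEquiv_symm_mem_baseChange H.hodgeLie hZM
  have hξA : ξ ∈ (Subalgebra.toSubmodule H.endAlg).baseChange ℂ :=
    endBaseChangeEquiv_symm_mem_baseChange (Subalgebra.toSubmodule H.endAlg)
      (by rw [Subalgebra.coe_toSubmodule]; exact hZA)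
  have hZ0 : Z ≠ 0 := LinearIndependent.ne_zero 3 hli
  obtain ⟨i, hi⟩ : ∃ i, ratCoord (Module.End ℚ V) ξ i ≠ 0 := by
    by_contra hcon
    push Not at hcon
    have hξ0 : ξ = 0 := (ratCoord (Module.End ℚ V)).injective (by rw [map_zero]; ext j; rw [hcon j, Finsupp.zero_apply])
    exact hZ0 (by rw [show Z = endBaseChangeEquiv V ξ by rw [hξ, LinearEquiv.apply_symm_apply], hξ0, map_zero])
  set φ := ratCoord (Module.End ℚ V) ξ i with hφdef
  have hφh : φ ∈ H.hodgeLie := ratCoord_mem_of_mem_baseChange _ hξh i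
  have hφA : φ ∈ H.endAlg := by
    have h := ratCoord_mem_of_mem_baseChange _ hξA i
    rwa [Subalgebra.mem_toSubmodule] at h
  have hφcA : ∀ a ∈ H.endAlg, φ * a = a * φ := fun a ha => H.commute_of_mem_hodgeLie hφh ⟨a, ha⟩
  have hφcen : ∀ W ∈ H.hodgeLieC, φ.baseChange ℂ * W = W * φ.baseChange ℂ :=
    fun W hW => (commute_baseChange_of_mem_hodgeLieC H hW ⟨φ, hφA⟩).symm
  -- `φ_ℂ = c₃ Z`
  set Φ := φ.baseChange ℂ with hΦdef
  have hΦP : Φ * P = P * Φ := by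
    have h := hφcen _ hΘ'
    rw [mul_sub Φ _ 1, sub_mul _ 1 Φ, mul_one, one_mul, mul_smul_comm, smul_mul_assoc, sub_left_inj] at h
    exact smul_right_injective _ (two_ne_zero' ℂ) h
  obtain ⟨c, hc⟩ := hspan _ (H.baseChange_mem_hodgeLieC hφh)
  rw [← hΦdef] at hc
  have hc1 : c 1 = 0 := by
    have h : P * Φ * (1 - P) = P * (c 0 • ((2 : ℂ) • P - 1) + c 1 • E + c 2 • F + c 3 • Z) * (1 - P) :=
      congrArg (fun T : Module.End ℂ (ℂ ⊗[ℚ] V) => P * T * (1 - P)) hc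
    rw [(blocks_D hPP hΦP).1] at h
    simp only [mul_add, add_mul, mul_smul_comm, smul_mul_assoc, (blocks_theta hPP).1, (blocks_E hPE hEP).1,
      (blocks_F hPF hFP).1, (blocks_D hPP hZP).1, smul_zero, zero_add, add_zero] at h
    exact (smul_eq_zero.1 h.symm).resolve_right hE0
  have hc2 : c 2 = 0 := by
    have h : (1 - P) * Φ * P = (1 - P) * (c 0 • ((2 : ℂ) • P - 1) + c 1 • E + c 2 • F + c 3 • Z) * P :=
      congrArg (fun T : Module.End ℂ (ℂ ⊗[ℚ] V) => (1 - P) * T * P) hc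
    rw [(blocks_D hPP hΦP).2] at h
    simp only [mul_add, add_mul, mul_smul_comm, smul_mul_assoc, (blocks_theta hPP).2, (blocks_E hPE hEP).2,
      (blocks_F hPF hFP).2, (blocks_D hPP hZP).2, smul_zero, zero_add, add_zero] at h
    exact (smul_eq_zero.1 h.symm).resolve_right hF0
  rw [hc1, hc2, zero_smul, zero_smul, add_zero, add_zero] at hc
  have hc0 : c 0 = 0 := by
    -- `[Φ, E] = 2 c₀ E = 0`
    have h := hφcen _ hEM
    rw [hc, add_mul, mul_add, smul_mul_assoc, smul_mul_assoc, mul_smul_comm, mul_smul_comm, hZcen _ hEM] at h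
    have h' : c 0 • (((2 : ℂ) • P - 1) * E - E * ((2 : ℂ) • P - 1)) = 0 := by
      rw [smul_sub, sub_eq_zero]; exact add_right_cancel h
    rw [(theta_bracket hPE hEP hPF hFP).1, smul_smul] at h'
    have h'' := (smul_eq_zero.1 h').resolve_right hE0
    exact (mul_eq_zero.1 h'').resolve_right (two_ne_zero' ℂ)
  rw [hc0, zero_smul, zero_add] at hc
  -- `hc : Φ = c 3 • Z`, with `c 3 ≠ 0`
  have hΦ0 : Φ ≠ 0 := by
    intro h
    apply hi
    have hmem : φ ∈ (⊥ : Submodule ℚ (Module.End ℚ V)) := by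
      apply mem_of_one_tmul_mem_baseChange
      rw [Submodule.baseChange_bot]
      have key : ((1 : ℂ) ⊗ₜ[ℚ] φ : ℂ ⊗[ℚ] Module.End ℚ V) = 0 := by
        apply (endBaseChangeEquiv V).injective
        rw [endBaseChangeEquiv_tmul, one_smul, map_zero, ← hΦdef, h]
      rw [key]
      exact Submodule.zero_mem _
    exact (Submodule.mem_bot ℚ).1 hmem
  have hc3 : c 3 ≠ 0 := fun h => hΦ0 (by rw [hc, h, zero_smul])
  have hZΦ : Z = (c 3)⁻¹ • Φ := by rw [hc, smul_smul, inv_mul_cancel₀ hc3, one_smul]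
  refine ⟨φ, hφh, hi, hφA, hφcA, ?_, ?_, α, β * (c 3)⁻¹, ?_⟩
  · rw [Fintype.linearIndependent_iff]
    intro g hg
    have hg' : g 0 • ((2 : ℂ) • P - 1) + g 1 • E + g 2 • F + g 3 • Φ = 0 := by
      simpa [Fin.sum_univ_four] using hg
    rw [hc, smul_smul] at hg'
    have h := Fintype.linearIndependent_iff.1 hli ![g 0, g 1, g 2, g 3 * c 3] (by simpa [Fin.sum_univ_four] using hg')
    have h3 : g 3 * c 3 = 0 := by simpa using h 3
    have h0 : g 0 = 0 := by simpa using h 0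
    have h1 : g 1 = 0 := by simpa using h 1
    have h2 : g 2 = 0 := by simpa using h 2
    have h3' : g 3 = 0 := (mul_eq_zero.1 h3).resolve_right hc3
    intro j
    fin_cases j <;> assumption
  · intro W hW
    obtain ⟨w, hw⟩ := hspan W hW
    refine ⟨![w 0, w 1, w 2, w 3 * (c 3)⁻¹], ?_⟩
    show W = w 0 • ((2 : ℂ) • P - 1) + w 1 • E + w 2 • F + (w 3 * (c 3)⁻¹) • Φ
    rw [hw, hZΦ, smul_smul]
  · rw [hEF, hZΦ, smul_smul]

end HodgeStructure

end Literature.AlgebraicGeometry.Motives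

end
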